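import Mathlib
import HarnessLib
import Literature.NumberTheory.DiophantineApproximation.SubspaceLattices
import Literature.NumberTheory.DiophantineApproximation.SubspaceMinima

/-!
# The Subspace Theorem over `ℚ` — III. Approximation domains `Π(Q)` (B–G 7.5.6–7.5.12)

Third file towards the `p`-adic Subspace Theorem over `ℚ` (Bombieri–Gubler §7.5 specialised to
`K = ℚ`, rational — here integral — linear forms, integer points). We fix the data of an
**approximation domain** (B–G 7.5.6): a finite set `S` of primes, integer `N × N` matrices `L`
(the forms at `∞`) and `M_p` (the forms at `p ∈ S`) with non-zero determinants, and real
exponents `c_{∞,i}`, `c_{p,i}` with `c_{p,i} ≤ 0` (for integer points and integral forms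
`|M_{p,i}(x)|_p ≤ 1`, so only `c_{p,i} ≤ 0` matters; cf. Step 0). For a level `Q ≥ 1`,
B–G's adelic parallelepiped `Π(Q) = ∏_v {|L_{v,i}(ξ)|_v ≤ Q^{c_{v,i}}}` meets `ℚ^N` in the
integer points `x` of the congruence lattice
`Λ(Q) = {x ∈ ℤ^N : |M_{p,i}(x)|_p ≤ Q^{c_{p,i}}}` (`SubspaceLattices.lean`, with exponents
`a_{p,i}(Q) = ⌈-c_{p,i} log Q / log p⌉`) lying in the real parallelepiped `{‖A_Q ξ‖_∞ ≤ 1}`,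
`A_Q = diag(Q^{-c_{∞,i}}) L`. We prove the volume/covolume bookkeeping of B–G Lemma 7.5.7 and
Corollary 7.5.8 in this language and deduce, from Minkowski's second theorem
(`SubspaceMinima.lean`), the estimate of B–G Lemma 7.5.12 / (7.41): the successive minima
`λ_1 ≤ ⋯ ≤ λ_N` of `Π(Q)` satisfy `c Q^{-Σ c} ≤ λ_1 ⋯ λ_N ≤ C Q^{-Σ c}` (`Σ c` the sum of ALL
exponents), so that `λ_N ≫ Q^{η/N}` when `Σ c ≤ -η < 0`.

Main definitions / results (namespace `Literature.NumberTheory.DiophantineApproximation.Subspace`):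
* `ApproxData N` — the data `(S, L, M, c_∞, c_p)`; `ApproxData.expo`, `.lat`, `.A`, `.csum`;
* `padicNorm_intCast_le_rpow_iff` — `|y|_p ≤ Q^c ⇔ p^{⌈-c log Q/log p⌉} ∣ y`;
* `ApproxData.mem_lat_iff` — `x ∈ Λ(Q) ⇔ |M_{p,i}(x)|_p ≤ Q^{c_{p,i}}` (B–G 7.5.6);
* `ApproxData.rpow_le_index_lat`, `ApproxData.index_lat_le` — Lemma 7.5.7 (b):
  `Q^{-Σ_{p,i} c_{p,i}} ≤ C₁ [ℤ^N : Λ(Q)] ≤ C₁ C₂ Q^{-Σ_{p,i} c_{p,i}}`;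
* `ApproxData.det_A` — Lemma 7.5.7 (c): `det A_Q = Q^{-Σ_i c_{∞,i}} det L`;
* `ApproxData.exists_minima` — a directional system of `Π(Q)` with
  `c_D Q^{-Σc} ≤ ∏ λ_k ≤ C_D Q^{-Σc}` (Minkowski + Lemma 7.5.7, i.e. Cor. 7.5.8 / Lemma 7.5.12).

## References
* [BombieriGubler2006] E. Bombieri, W. Gubler, *Heights in Diophantine Geometry*, CUP 2006,
  §7.5: 7.5.6, Lemma 7.5.7, Cor. 7.5.8, Def. 7.5.11, Lemma 7.5.12, (7.41).
-/

noncomputable section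

open Finset Matrix Module Real

namespace Literature.NumberTheory.DiophantineApproximation.Subspace

/-! ### `p`-adic inequalities `|y|_p ≤ Q^c` as divisibilities -/

/-- The exponent `a = ⌈-c log Q / log p⌉` with `Q^c ∈ (p^{-a-1}, p^{-a}]`… more precisely the
least `a ∈ ℕ` with `p^{-a} ≤ Q^c` (`c ≤ 0`, `Q ≥ 1`). [cite: BombieriGubler2006, 7.5.6] -/
def expoOf (p : ℕ) (Q c : ℝ) : ℕ := ⌈-c * Real.log Q / Real.log p⌉₊

/-- Unfolding lemma for `expoOf`. [folklore] -/
theorem expoOf_def (p : ℕ) (Q c : ℝ) : expoOf p Q c = ⌈-c * Real.log Q / Real.log p⌉₊ := rfl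

/-- For `p > 1`, `Q > 0`: `p^{-(-c log Q/log p)} = Q^c`. [folklore] -/
theorem rpow_neg_aux {p : ℕ} (hp : 1 < p) {Q : ℝ} (hQ : 0 < Q) (c : ℝ) :
    (p : ℝ) ^ (-(-c * Real.log Q / Real.log p)) = Q ^ c := by
  have hp0 : (0 : ℝ) < p := by exact_mod_cast (zero_lt_one.trans hp)
  have hlogp : Real.log p ≠ 0 := Real.log_ne_zero_of_pos_of_ne_one hp0 (by exact_mod_cast hp.ne')
  rw [Real.rpow_def_of_pos hp0, Real.rpow_def_of_pos hQ]
  congr 1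
  field_simp

/-- For `p > 1`, `Q > 0`: `p^{-c log Q/log p} = Q^{-c}`. [folklore] -/
theorem rpow_aux {p : ℕ} (hp : 1 < p) {Q : ℝ} (hQ : 0 < Q) (c : ℝ) :
    (p : ℝ) ^ (-c * Real.log Q / Real.log p) = Q ^ (-c) := by
  have := rpow_neg_aux hp hQ (-c)
  rw [neg_neg] at this
  rw [← this]
  congr 1
  ring

/-- **`|y|_p ≤ Q^c ⇔ p^a ∣ y`** with `a = ⌈-c log Q / log p⌉`, for an integer `y`, a prime `p`,
`Q ≥ 1` (and any real `c`; in the application `c ≤ 0`). [folklore] -/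
theorem padicNorm_intCast_le_rpow_iff {p : ℕ} [hp : Fact p.Prime] {Q : ℝ} (hQ : 1 ≤ Q) (c : ℝ)
    (y : ℤ) :
    ((padicNorm p (y : ℚ) : ℚ) : ℝ) ≤ Q ^ c ↔ (p : ℤ) ^ expoOf p Q c ∣ y := by
  have hp1 : 1 < p := hp.out.one_lt
  have hp1r : (1 : ℝ) < p := by exact_mod_cast hp1
  have hQ0 : 0 < Q := one_pos.trans_le hQ
  by_cases hy : y = 0
  · subst hy
    simp only [Int.cast_zero, padicNorm.zero, Rat.cast_zero, dvd_zero, iff_true]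
    positivity
  · set t : ℝ := -c * Real.log Q / Real.log p with ht
    have hnorm : ((padicNorm p (y : ℚ) : ℚ) : ℝ) = (p : ℝ) ^ (-(padicValInt p y : ℝ)) := by
      rw [padicNorm.eq_zpow_of_nonzero (by exact_mod_cast hy), padicValRat.of_int]
      push_cast
      rw [← Real.rpow_intCast]
      push_cast
      rfl
    rw [hnorm, ← rpow_neg_aux hp1 hQ0 c, ← ht, Real.rpow_le_rpow_left_iff hp1r, neg_le_neg_iff,
      expoOf_def, ← ht, padicValInt_dvd_iff, ← Nat.ceil_le]
    simp [hy]

/-- `Q^{-c} ≤ p^a` for `a = ⌈-c log Q/log p⌉` (`p > 1`, `Q ≥ 1`). [folklore] -/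
theorem rpow_neg_le_pow_expoOf {p : ℕ} (hp : 1 < p) {Q : ℝ} (hQ : 1 ≤ Q) (c : ℝ) :
    Q ^ (-c) ≤ (p : ℝ) ^ expoOf p Q c := by
  have hp1r : (1 : ℝ) ≤ p := by exact_mod_cast hp.le
  rw [← rpow_aux hp (one_pos.trans_le hQ) c, expoOf_def, ← Real.rpow_natCast]
  exact Real.rpow_le_rpow_of_exponent_le hp1r (Nat.le_ceil _)

/-- `p^a < p · Q^{-c}` for `a = ⌈-c log Q/log p⌉` (`p > 1`, `Q ≥ 1`, `c ≤ 0`). [folklore] -/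
theorem pow_expoOf_lt {p : ℕ} (hp : 1 < p) {Q : ℝ} (hQ : 1 ≤ Q) {c : ℝ} (hc : c ≤ 0) :
    ((p : ℝ) ^ expoOf p Q c : ℝ) < p * Q ^ (-c) := by
  have hp1r : (1 : ℝ) < p := by exact_mod_cast hp
  have hp0 : (0 : ℝ) < p := by positivity
  have ht0 : 0 ≤ -c * Real.log Q / Real.log p := by
    apply div_nonneg
    · exact mul_nonneg (neg_nonneg.mpr hc) (Real.log_nonneg hQ)
    · exact Real.log_nonneg hp1r.le
  rw [← rpow_aux hp (one_pos.trans_le hQ) c, expoOf_def, ← Real.rpow_natCast]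
  calc (p : ℝ) ^ ((⌈-c * Real.log Q / Real.log p⌉₊ : ℕ) : ℝ)
      < (p : ℝ) ^ (-c * Real.log Q / Real.log p + 1) :=
        (Real.rpow_lt_rpow_left_iff hp1r).mpr (Nat.ceil_lt_add_one ht0)
    _ = p * (p : ℝ) ^ (-c * Real.log Q / Real.log p) := by
        rw [Real.rpow_add_one hp0.ne', mul_comm]

/-! ### The data of an approximation domain (B–G 7.5.6) -/

/-- **Data of an approximation domain** over `ℚ` (B–G 7.5.6 for `K = ℚ`, integral forms): a
finite set `S` of primes, the integer forms `L` at `∞` and `M_p` at `p ∈ S` (square matrices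
with non-zero determinant, rows = forms), and real exponents `c_{∞,i}`, `c_{p,i}` with
`c_{p,i} ≤ 0`. [cite: BombieriGubler2006, 7.5.6] -/
structure ApproxData (N : ℕ) where
  /-- the finite set of primes `S ∖ {∞}` -/
  S : Finset ℕ
  /-- all elements of `S` are prime -/
  prime : ∀ p ∈ S, p.Prime
  /-- the forms at the archimedean place (rows of an integer matrix) -/
  L : Matrix (Fin N) (Fin N) ℤ
  /-- the forms at `∞` are independent -/
  detL : L.det ≠ 0
  /-- the forms at the primes `p ∈ S` -/
  M : ℕ → Matrix (Fin N) (Fin N) ℤ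
  /-- the forms at `p ∈ S` are independent -/
  detM : ∀ p ∈ S, (M p).det ≠ 0
  /-- the exponents `c_{∞,i}` -/
  cinf : Fin N → ℝ
  /-- the exponents `c_{p,i}` -/
  cp : ℕ → Fin N → ℝ
  /-- the exponents at the finite places are non-positive -/
  cp_nonpos : ∀ p ∈ S, ∀ i, cp p i ≤ 0

namespace ApproxData

variable {N : ℕ} (D : ApproxData N)

/-- The exponents `a_{p,i}(Q) = ⌈-c_{p,i} log Q / log p⌉` of the congruence lattice at level `Q`.
[cite: BombieriGubler2006, 7.5.6] -/
def expo (Q : ℝ) (p : ℕ) (i : Fin N) : ℕ := expoOf p Q (D.cp p i)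

/-- **The congruence lattice `Λ(Q)`**: the integer points of the non-archimedean part of `Π(Q)`.
[cite: BombieriGubler2006, 7.5.6] -/
def lat (Q : ℝ) : AddSubgroup (Fin N → ℤ) := lattice D.S D.M (D.expo Q)

/-- **The matrix `A_Q = diag(Q^{-c_{∞,i}}) L`** whose sup-gauge `‖A_Q ξ‖_∞ ≤ 1` is the archimedean
factor `{|L_i(ξ)| ≤ Q^{c_{∞,i}}}` of `Π(Q)`. [cite: BombieriGubler2006, 7.5.6] -/
def A (Q : ℝ) : Matrix (Fin N) (Fin N) ℝ :=
  Matrix.of fun i j => Q ^ (-D.cinf i) * (D.L i j : ℝ)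

/-- The sum of the archimedean exponents `Σ_i c_{∞,i}`. [cite: BombieriGubler2006, Lemma 7.5.7] -/
def cinfSum : ℝ := ∑ i, D.cinf i

/-- The sum of the non-archimedean exponents `Σ_{p∈S} Σ_i c_{p,i}`.
[cite: BombieriGubler2006, Lemma 7.5.7] -/
def cpSum : ℝ := ∑ p ∈ D.S, ∑ i, D.cp p i

/-- The total exponent sum `Σ_{v,i} c_{v,i}`. [cite: BombieriGubler2006, (7.22)] -/
def csum : ℝ := D.cinfSum + D.cpSum

/-- The constant `C₁ = ∏_{p∈S} |det M_p|^N` of the index lower bound. [folklore] -/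
def C₁ : ℕ := ∏ p ∈ D.S, (D.M p).det.natAbs ^ N

/-- The constant `C₂ = ∏_{p∈S} p^N` of the index upper bound. [folklore] -/
def C₂ : ℕ := ∏ p ∈ D.S, p ^ N

/-- `C₁ ≥ 1`. [folklore] -/
theorem one_le_C₁ : 1 ≤ D.C₁ := by
  unfold C₁
  refine Nat.one_le_iff_ne_zero.mpr (Finset.prod_ne_zero_iff.mpr fun p hp => ?_)
  exact pow_ne_zero _ (Int.natAbs_ne_zero.mpr (D.detM p hp))

/-- `C₂ ≥ 1`. [folklore] -/
theorem one_le_C₂ : 1 ≤ D.C₂ := by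
  unfold C₂
  refine Nat.one_le_iff_ne_zero.mpr (Finset.prod_ne_zero_iff.mpr fun p hp => ?_)
  exact pow_ne_zero _ (D.prime p hp).ne_zero

/-! ### Membership, index and determinant -/

/-- **`x ∈ Λ(Q)` iff `|M_{p,i}(x)|_p ≤ Q^{c_{p,i}}` for all `p ∈ S` and `i`** (`Q ≥ 1`): the
non-archimedean conditions of B–G's `ι(x) ∈ Π(Q)`. [cite: BombieriGubler2006, 7.5.6] -/
theorem mem_lat_iff {Q : ℝ} (hQ : 1 ≤ Q) (x : Fin N → ℤ) :
    x ∈ D.lat Q ↔ ∀ p ∈ D.S, ∀ i,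
      ((padicNorm p (((D.M p *ᵥ x) i : ℤ) : ℚ) : ℚ) : ℝ) ≤ Q ^ D.cp p i := by
  rw [lat, mem_lattice]
  refine forall₂_congr fun p hp => forall_congr' fun i => ?_
  haveI : Fact p.Prime := ⟨D.prime p hp⟩
  rw [padicNorm_intCast_le_rpow_iff hQ (D.cp p i)]
  rfl

/-- `Λ(Q)` has finite index. [folklore] -/
theorem index_lat_ne_zero (Q : ℝ) : (D.lat Q).index ≠ 0 :=
  index_lattice_ne_zero D.S (fun p hp => (D.prime p hp).pos) D.M _

/-- **Index lower bound** (B–G Lemma 7.5.7 (b), `K = ℚ`): `Q^{-Σ_{p,i} c_{p,i}} ≤ C₁ [ℤ^N : Λ(Q)]`.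
[cite: BombieriGubler2006, Lemma 7.5.7 (b)] -/
theorem rpow_le_index_lat {Q : ℝ} (hQ : 1 ≤ Q) :
    Q ^ (-D.cpSum) ≤ D.C₁ * (D.lat Q).index := by
  have hQ0 : 0 < Q := one_pos.trans_le hQ
  have h := prod_pow_le_index_lattice D.S D.prime D.M D.detM (D.expo Q)
  rw [Fintype.card_fin] at h
  have hcast : ((∏ p ∈ D.S, ∏ i, p ^ D.expo Q p i : ℕ) : ℝ) ≤ (D.C₁ : ℝ) * (D.lat Q).index := by
    unfold C₁ lat
    exact_mod_cast h
  refine le_trans ?_ hcast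
  rw [cpSum, ← Finset.sum_neg_distrib, Real.rpow_sum_of_pos hQ0]
  push_cast
  refine Finset.prod_le_prod (fun p _ => by positivity) fun p hp => ?_
  rw [← Finset.sum_neg_distrib, Real.rpow_sum_of_pos hQ0]
  refine Finset.prod_le_prod (fun i _ => by positivity) fun i _ => ?_
  exact rpow_neg_le_pow_expoOf (D.prime p hp).one_lt hQ _

/-- **Index upper bound** (B–G Lemma 7.5.7 (b), `K = ℚ`): `[ℤ^N : Λ(Q)] ≤ C₂ Q^{-Σ_{p,i} c_{p,i}}`.
[cite: BombieriGubler2006, Lemma 7.5.7 (b)] -/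
theorem index_lat_le {Q : ℝ} (hQ : 1 ≤ Q) :
    ((D.lat Q).index : ℝ) ≤ D.C₂ * Q ^ (-D.cpSum) := by
  have hQ0 : 0 < Q := one_pos.trans_le hQ
  have h := index_lattice_le D.S (fun p hp => (D.prime p hp).pos) D.M (D.expo Q)
  have hcast : ((D.lat Q).index : ℝ) ≤ ((∏ p ∈ D.S, ∏ i, p ^ D.expo Q p i : ℕ) : ℝ) := by
    unfold lat
    exact_mod_cast h
  refine hcast.trans ?_
  rw [cpSum, ← Finset.sum_neg_distrib, Real.rpow_sum_of_pos hQ0, C₂]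
  push_cast
  rw [← Finset.prod_mul_distrib]
  refine Finset.prod_le_prod (fun p _ => by positivity) fun p hp => ?_
  rw [← Finset.sum_neg_distrib, Real.rpow_sum_of_pos hQ0, ← Fin.prod_const, ← Finset.prod_mul_distrib]
  refine Finset.prod_le_prod (fun i _ => by positivity) fun i _ => ?_
  exact (pow_expoOf_lt (D.prime p hp).one_lt hQ (D.cp_nonpos p hp i)).le

/-- Entries of `A_Q ξ`: `(A_Q ξ)_i = Q^{-c_{∞,i}} L_i(ξ)`. [folklore] -/
theorem A_mulVec (Q : ℝ) (ξ : Fin N → ℝ) (i : Fin N) :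
    (D.A Q *ᵥ ξ) i = Q ^ (-D.cinf i) * (D.L.map (Int.cast : ℤ → ℝ) *ᵥ ξ) i := by
  simp only [A, mulVec, dotProduct, Matrix.of_apply, Matrix.map_apply, Finset.mul_sum]
  refine Finset.sum_congr rfl fun j _ => by ring

/-- `A_Q = diag(Q^{-c_{∞,i}}) · L`. [folklore] -/
theorem A_eq_diagonal_mul (Q : ℝ) :
    D.A Q = Matrix.diagonal (fun i => Q ^ (-D.cinf i)) * D.L.map (Int.cast : ℤ → ℝ) := by
  ext i j
  simp [A, diagonal_mul, Matrix.map_apply]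

/-- **B–G Lemma 7.5.7 (c) for `K = ℚ`:** `det A_Q = Q^{-Σ_i c_{∞,i}} det L` (the archimedean
volume factor). [cite: BombieriGubler2006, Lemma 7.5.7 (c)] -/
theorem det_A {Q : ℝ} (hQ : 0 < Q) : (D.A Q).det = Q ^ (-D.cinfSum) * (D.L.det : ℝ) := by
  rw [A_eq_diagonal_mul, det_mul, det_diagonal, cinfSum, ← Finset.sum_neg_distrib,
    Real.rpow_sum_of_pos hQ, Int.cast_det]

/-- `det A_Q ≠ 0`. [folklore] -/
theorem det_A_ne_zero {Q : ℝ} (hQ : 0 < Q) : (D.A Q).det ≠ 0 := by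
  rw [D.det_A hQ]
  refine mul_ne_zero ?_ (by exact_mod_cast D.detL)
  exact (Real.rpow_pos_of_pos hQ _).ne'

/-- `‖A_Q ξ‖ ≤ t` iff `|L_i(ξ)| ≤ t Q^{c_{∞,i}}` for all `i` (`Q > 0`, `t ≥ 0`): for `t = 1`
the archimedean conditions of `ι(x) ∈ Π(Q)`. [cite: BombieriGubler2006, 7.5.6] -/
theorem norm_A_mulVec_le_iff {Q : ℝ} (hQ : 0 < Q) {t : ℝ} (ht : 0 ≤ t) (ξ : Fin N → ℝ) :
    ‖D.A Q *ᵥ ξ‖ ≤ t ↔ ∀ i, |(D.L.map (Int.cast : ℤ → ℝ) *ᵥ ξ) i| ≤ t * Q ^ D.cinf i := by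
  rw [pi_norm_le_iff_of_nonneg ht]
  refine forall_congr' fun i => ?_
  rw [Real.norm_eq_abs, A_mulVec, abs_mul, abs_of_pos (Real.rpow_pos_of_pos hQ _),
    Real.rpow_neg hQ.le, ← div_eq_inv_mul, div_le_iff₀ (Real.rpow_pos_of_pos hQ _)]

/-! ### Successive minima of `Π(Q)` (B–G Cor. 7.5.8, Lemma 7.5.12, (7.41)) -/

/-- The lower constant `c₃ = |det L| / (N! C₁)`. [folklore] -/
def c₃ : ℝ := |(D.L.det : ℝ)| / (N.factorial * D.C₁)

/-- The upper constant `C₄ = |det L| C₂`. [folklore] -/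
def C₄ : ℝ := |(D.L.det : ℝ)| * D.C₂

/-- `c₃ > 0`. [folklore] -/
theorem c₃_pos : 0 < D.c₃ := by
  unfold c₃
  refine div_pos (abs_pos.mpr (by exact_mod_cast D.detL)) ?_
  have := D.one_le_C₁
  positivity

/-- `C₄ > 0`. [folklore] -/
theorem C₄_pos : 0 < D.C₄ := by
  unfold C₄
  refine mul_pos (abs_pos.mpr (by exact_mod_cast D.detL)) ?_
  have := D.one_le_C₂
  positivity

/-- **Successive minima of `Π(Q)`** (B–G Cor. 7.5.8 with Minkowski's second theorem, as used in
Lemma 7.5.12 and (7.41), for `K = ℚ`): for `Q ≥ 1` there is a directional system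
`v₀, …, v_{N-1} ∈ Λ(Q)` of the parallelepiped `{‖A_Q ξ‖ ≤ 1}` — independent, with
`λ_{k+1} := ‖A_Q v_k‖` non-decreasing and every `z ∈ Λ(Q)` with `‖A_Q z‖ < λ_{k+1}` in
`span_ℝ(v₀,…,v_{k-1})` — and `c₃ Q^{-Σc} ≤ λ_1 ⋯ λ_N ≤ C₄ Q^{-Σc}`, `Σc` the total exponent sum.
[cite: BombieriGubler2006, Cor. 7.5.8 and Lemma 7.5.12] -/
theorem exists_minima (hN : 0 < N) {Q : ℝ} (hQ : 1 ≤ Q) :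
    ∃ v : Fin N → Fin N → ℤ, (∀ k, v k ∈ D.lat Q) ∧
      LinearIndependent ℝ (fun k => castVec (v k)) ∧
      Monotone (fun k => ‖D.A Q *ᵥ castVec (v k)‖) ∧
      (∀ k : Fin N, ∀ z ∈ D.lat Q, ‖D.A Q *ᵥ castVec z‖ < ‖D.A Q *ᵥ castVec (v k)‖ →
        castVec z ∈ Submodule.span ℝ ((fun k => castVec (v k)) '' {l | l < k})) ∧
      ∏ k, ‖D.A Q *ᵥ castVec (v k)‖ ≤ D.C₄ * Q ^ (-D.csum) ∧
      D.c₃ * Q ^ (-D.csum) ≤ ∏ k, ‖D.A Q *ᵥ castVec (v k)‖ := by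
  have hQ0 : 0 < Q := one_pos.trans_le hQ
  obtain ⟨v, hv, hli, hmono, hdir, hprod⟩ :=
    exists_directional_prod_le hN (D.A Q) (D.det_A_ne_zero hQ0) (D.lat Q) (D.index_lat_ne_zero Q)
  have hlow := det_mul_index_le_prod (D.A Q) (D.lat Q) (D.index_lat_ne_zero Q) v hv hli
  have hdet : |(D.A Q).det| = Q ^ (-D.cinfSum) * |(D.L.det : ℝ)| := by
    rw [D.det_A hQ0, abs_mul, abs_of_pos (Real.rpow_pos_of_pos hQ0 _)]
  have hsplit : Q ^ (-D.csum) = Q ^ (-D.cinfSum) * Q ^ (-D.cpSum) := by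
    rw [csum, neg_add, Real.rpow_add hQ0]
  refine ⟨v, hv, hli, hmono, hdir, ?_, ?_⟩
  · -- upper bound
    calc ∏ k, ‖D.A Q *ᵥ castVec (v k)‖ ≤ |(D.A Q).det| * (D.lat Q).index := hprod
      _ ≤ Q ^ (-D.cinfSum) * |(D.L.det : ℝ)| * (D.C₂ * Q ^ (-D.cpSum)) := by
          rw [hdet]
          exact mul_le_mul_of_nonneg_left (D.index_lat_le hQ) (by positivity)
      _ = D.C₄ * Q ^ (-D.csum) := by rw [hsplit, C₄]; ring
  · -- lower bound
    have hidx := D.rpow_le_index_lat hQ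
    have hC1 : (0 : ℝ) < D.C₁ := by exact_mod_cast D.one_le_C₁
    have hfac : (0 : ℝ) < N.factorial := by exact_mod_cast N.factorial_pos
    have h1 : Q ^ (-D.cinfSum) * |(D.L.det : ℝ)| * Q ^ (-D.cpSum) ≤
        D.C₁ * (N.factorial * ∏ k, ‖D.A Q *ᵥ castVec (v k)‖) := by
      calc Q ^ (-D.cinfSum) * |(D.L.det : ℝ)| * Q ^ (-D.cpSum)
          ≤ Q ^ (-D.cinfSum) * |(D.L.det : ℝ)| * (D.C₁ * (D.lat Q).index) :=
            mul_le_mul_of_nonneg_left hidx (by positivity)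
        _ = D.C₁ * (|(D.A Q).det| * (D.lat Q).index) := by rw [hdet]; ring
        _ ≤ D.C₁ * (N.factorial * ∏ k, ‖D.A Q *ᵥ castVec (v k)‖) :=
            mul_le_mul_of_nonneg_left hlow hC1.le
    rw [c₃, hsplit, div_mul_eq_mul_div, div_le_iff₀ (by positivity)]
    calc |(D.L.det : ℝ)| * (Q ^ (-D.cinfSum) * Q ^ (-D.cpSum))
        = Q ^ (-D.cinfSum) * |(D.L.det : ℝ)| * Q ^ (-D.cpSum) := by ring
      _ ≤ D.C₁ * (N.factorial * ∏ k, ‖D.A Q *ᵥ castVec (v k)‖) := h1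
      _ = (∏ k, ‖D.A Q *ᵥ castVec (v k)‖) * (N.factorial * D.C₁) := by ring

end ApproxData

end Literature.NumberTheory.DiophantineApproximation.Subspace
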